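import Mathlib.FieldTheory.RatFunc.AsPolynomial
import Literature.AnabelianGeometry.AbsoluteAnabelian.AbsTopIII.KummerPU
import Literature.AnabelianGeometry.AbsoluteAnabelian.MLFGaloisTypeProofs
import Literature.AnabelianGeometry.AbsoluteAnabelian.SubpadicExamples
import HarnessLib

/-!
# [AbsTopIII] Prop. 1.8 (i), (ii): the model-relative schemata `Prop_1_8_i M`, `Prop_1_8_ii M`
# (FACT-LIST F-0379 / F-0380) — kernel classification of their universal closures

Mochizuki, *Topics in Absolute Anabelian Geometry III*, §1, Prop. 1.8 p. 36 ("(i) A class `η ∈ P_U` is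
the Kummer class of a nonconstant NF-rational function if and only if there exist a positive multiple
`η†` of `η` and NF-points `x₁, x₂ ∈ U(k_x)` [...] such that `η†|_{x₁} = 0`, `η†|_{x₂} ≠ 0`"; "(ii) [...] a
class `η ∈ P_U ⋂ H¹(G_k, M_X)` is the Kummer class of an NF-constant `∈ k^×` if and only if there exist a
nonconstant NF-rational function `f` [...] and an NF-point `x` [...] such that `κ_U(f)|_x = η|_{G_{k_x}}`"),
manuscript pagination (lit key `paper:url-5493eb38cbb7`).  Negative knowledge recorded next to
`KummerPU.lean` (abc-iut-L4-t1), PROOF-ONLY (no `def`, no `instance`, no `structure`: the model lives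
inside a theorem term), abc-iut cell seat abc-iut-f-085 (F fact-proving wave, tranche 85, rows **F-0379**
`IntrinsicKummerModel.Prop_1_8_i`, **F-0380** `IntrinsicKummerModel.Prop_1_8_ii`; kernel-closedness
`parametrised`).

Both rows are predicates ON A MODEL `M : IntrinsicKummerModel` — the interface standing in for the
étale `π₁` of hyperbolic curves together with "the associated Kummer map `κ_U`" (Prop. 1.6 p. 34), whose
field `kummerMap` is FREE data — guarded by `IsKummerFaithful (M.base U)`.  This file proves the exact
strength of their universal closures (rule R7's "the fact proved"):

* `IntrinsicKummerModel.exists_junkModel_noPoints` — over ANY Kummer-faithful field `k`, a one-curve model meeting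
  every guard of Prop. 1.8 (scheme-like, proper, genus `2`, all cusps rational — there are none — NF-curve)
  with `Π_U = G_k = Gal(k̄/k)` (so `Δ_U = 1`), NO closed points, `K_U := k(X)` (Mathlib `RatFunc k`) with
  every function flagged NF-rational and every constant NF-constant, and the TRIVIAL Kummer map; the unit
  `X ∈ k(X)^×` is a nonconstant regular unit with `κ_U(X) = 0`.  (Honest label: junk data, not a curve.)
* `IntrinsicKummerModel.forall_prop_1_8_i_iff`, `forall_prop_1_8_ii_iff` — **the universal closure of each
  row holds if and only if NO Kummer-faithful field exists** (in the universe at hand): (⇐) vacuity through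
  the guard; (⇒) at the junk model the class `η := 0 ∈ P_U ⋂ H¹(G_k, M_X)` is the Kummer class of the
  nonconstant NF-rational unit `X` (resp. of the NF-constant `1`), while the printed criterion fails for
  want of NF-points.
* `not_forall_prop_1_8_i_of_isKummerFaithful`, `…_ii_…` — hence ONE Kummer-faithful field refutes both
  closures; `not_forall_prop_1_8_i_of_rmk_1_5_4_i`, `…_ii_…` — in particular they are **REFUTED modulo the
  FACT-LIST row F-0369** `Rmk_1_5_4_i` ("sub-`p`-adic ⟹ Kummer-faithful", Rmk. 1.5.4 (i) p. 33) at
  `k := ℚ₂` (`IsSubpadic.of_isMLF (isMLF_padic 2)`), universe `0`.  No Kummer-faithful field is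
  constructed in the tree today (the abelian-variety clause of Def. 1.5 is Mattuck's theorem), which is why
  the refutation is stated relative to that row and not absolutely.

READING (honest scope).  This classifies OUR typing: the rows carry genuine content beyond the interface
(they fail at junk Kummer data), so they can be consumed only as the model-relative hypotheses
`M.Prop_1_8_i` / `M.Prop_1_8_ii` at a coherent `M` — which is exactly how every consumer binds them
(`Thm19KummerContainerPartsProofs`, `Thm19KummerTowerProofs`, …, variable `M`) — FACT-LIST class
«universal-closure REFUTED (modulo F-0369) / schema; instance forms open».  At the intended model the rows
are Mochizuki's Prop. 1.8, untouched.  Nothing here bears on the disputed [IUTchIII] Cor. 3.12 or takes a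
side on any author.
-/

noncomputable section

namespace Literature.AnabelianGeometry.AbsoluteAnabelian.AbsTopIII

open CategoryTheory

universe u

namespace IntrinsicKummerModel

/-! ### The junk model over a Kummer-faithful field -/

/-- **A one-curve `IntrinsicKummerModel` with trivial Kummer map over any Kummer-faithful field `k`.**
Its single curve `U` (serving as its own proper compactification, `IsCofiniteOpen U U`) is flagged
scheme-like, proper, of genus `2`, an NF-curve; `Π_U = G_k := Gal(k̄/k)` with identity augmentation (so
`Δ_U = 1`); no cusps, no closed points; `K_U := k(X)`; every rational function is flagged NF-rational and
every constant NF-constant; `κ_U := 1`.  Recorded consequences: the guards of Prop. 1.8 hold, every Kummer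
class vanishes, and `X` is a nonconstant unit (`RatFunc.num_X`, `Polynomial.X_ne_C`).  JUNK DATA witnessing
the freedom of the interface, not a curve. [cite: MochizukiAbsTopIII2015, Prop 1.6 p.34] -/
theorem exists_junkModel_noPoints {k : Type u} [Field k] (hk : IsKummerFaithful k) :
    ∃ (M : IntrinsicKummerModel.{u}) (U : M.Curve) (h : M.IsCofiniteOpen U U) (hU : M.IsProper U),
      M.IsScheme U ∧ 2 ≤ M.genus U ∧ IsKummerFaithful (M.base U) ∧ IsEmpty (M.cusps U).Cusp ∧
        IsEmpty (M.Point U) ∧ M.IsNFCurve U ∧ (∀ g : M.FunctionField U, M.IsNFRational U g) ∧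
          (∀ c : M.base U, M.IsNFConstant U c) ∧
            (∀ f : M.regularUnits U, M.kummerMap h hU f = 1) ∧
              ∃ f : (M.FunctionField U)ˣ, ¬ M.IsConstantUnit f := by
  haveI : CharZero k := hk.torally.charZero
  let E₀ : FundamentalExtension.{u} :=
    { arith := absoluteGaloisGrp k, gal := absoluteGaloisGrp k, aug := ContinuousMonoidHom.id _,
      aug_surjective := Function.surjective_id }
  refine ⟨{ Curve := PUnit.{u + 2}
            base := fun _ => k
            ext := fun _ => E₀
            galIso := fun _ => Iso.refl _
            cusps := fun _ =>
              { Cusp := PEmpty.{u + 1}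
                Dcusp := fun x => x.elim
                Icusp := fun x => x.elim
                Icusp_eq := fun x => x.elim
                isClosed_Dcusp := fun x => x.elim
                eq_of_conj := fun x => x.elim }
            IsProper := fun _ => True
            IsScheme := fun _ => True
            genus := fun _ => 2
            FunctionField := fun _ => RatFunc k
            Point := fun _ => PEmpty.{u + 1}
            decomp := fun _ x => x.elim
            IsNFCurve := fun _ => True
            IsNFPoint := fun _ x => x.elim
            IsNFRational := fun _ _ => True
            IsNFConstant := fun _ _ => True
            NFFunctionField := fun _ => k
            IsStrictlyBelyiType := fun _ => True
            IsCofiniteOpen := fun _ _ => True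
            res := fun {_ _} _ => 𝟙 E₀
            IsRationalPt := fun _ x => x.elim
            ptSection := fun {_} x _ => x.elim
            ptSection_range := fun {_} x _ => x.elim
            ord := fun {_} x => x.elim
            kummerMap := fun {_ _} _ _ => 1 },
    PUnit.unit, trivial, trivial, trivial, le_rfl, hk, PEmpty.instIsEmpty, PEmpty.instIsEmpty,
    trivial, fun _ => trivial, fun _ => trivial, fun _ => rfl,
    Units.mk0 RatFunc.X RatFunc.X_ne_zero, ?_⟩
  rintro ⟨c, hc⟩
  change algebraMap k (RatFunc k) c = RatFunc.X at hc
  rw [RatFunc.algebraMap_eq_C] at hc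
  have hnum := congrArg RatFunc.num hc
  rw [RatFunc.num_C, RatFunc.num_X] at hnum
  exact Polynomial.X_ne_C c hnum.symm

/-! ### Prop. 1.8 (i): F-0379 -/

/-- **FACT-LIST F-0379, kernel classification of the universal closure.**  `∀ M, Prop_1_8_i M` holds
IF AND ONLY IF no Kummer-faithful field exists (in universe `u`): (⇐) the guard `IsKummerFaithful (M.base U)`
is then never met; (⇒) at the junk model over a Kummer-faithful `k` (`exists_junkModel_noPoints`) the class
`η := 0 ∈ P_U` IS the Kummer class of the nonconstant NF-rational regular unit `X` (trivial Kummer map),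
but no positive multiple of `0` has a nonzero restriction anywhere (and there are no NF-points), so the
printed criterion fails. [cite: MochizukiAbsTopIII2015, Prop 1.8 (i) p.36] -/
theorem forall_prop_1_8_i_iff :
    (∀ M : IntrinsicKummerModel.{u}, M.Prop_1_8_i) ↔
      ∀ (k : Type u) [Field k], ¬ IsKummerFaithful k := by
  constructor
  · intro hall k _ hk
    obtain ⟨M, U, h, hU, hsch, hg, hkf, _, hpt, hnf, hrat, -, hκ, f, hf⟩ := exists_junkModel_noPoints hk
    have hreg : f ∈ M.regularUnits U := fun x => isEmptyElim x
    have hiff := hall M U U h hU hsch hsch hg hkf (fun c => isEmptyElim c) hnf 0 (zero_mem _)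
    obtain ⟨n, -, x₁, -⟩ := hiff.1 ⟨⟨f, hreg⟩, hrat _, hf, by rw [hκ]; rfl⟩
    exact isEmptyElim x₁
  · intro hno M U X h hX _ _ _ hk
    exact absurd hk (hno (M.base U))

/-- **F-0379: one Kummer-faithful field refutes the universal closure of `Prop_1_8_i`.**
[cite: MochizukiAbsTopIII2015, Prop 1.8 (i) p.36] -/
theorem not_forall_prop_1_8_i_of_isKummerFaithful {k : Type u} [Field k] (hk : IsKummerFaithful k) :
    ¬ ∀ M : IntrinsicKummerModel.{u}, M.Prop_1_8_i :=
  fun h => forall_prop_1_8_i_iff.1 h k hk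

/-- **F-0379, universal closure REFUTED modulo F-0369** (`Rmk_1_5_4_i`: "sub-`p`-adic ⟹ Kummer-faithful",
Rmk. 1.5.4 (i) p. 33), at `k := ℚ₂` (an MLF, hence sub-`2`-adic), universe `0` — hence the
universe-polymorphic R7 closure has no proof once F-0369 is granted.  The instance form `M.Prop_1_8_i` at a
coherent model is untouched. [cite: MochizukiAbsTopIII2015, Prop 1.8 (i) p.36] -/
theorem not_forall_prop_1_8_i_of_rmk_1_5_4_i (h154 : Rmk_1_5_4_i.{0}) :
    ¬ ∀ M : IntrinsicKummerModel.{0}, M.Prop_1_8_i :=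
  haveI : Fact (Nat.Prime 2) := ⟨Nat.prime_two⟩
  not_forall_prop_1_8_i_of_isKummerFaithful (h154 ℚ_[2] (IsSubpadic.of_isMLF (isMLF_padic 2)))

/-! ### Prop. 1.8 (ii): F-0380 -/

/-- **FACT-LIST F-0380, kernel classification of the universal closure.**  `∀ M, Prop_1_8_ii M` holds
IF AND ONLY IF no Kummer-faithful field exists (in universe `u`): (⇐) vacuity through the guard; (⇒) at
the junk model over a Kummer-faithful `k` the standing hypothesis of (ii) is met by the nonconstant
NF-rational unit `X`, the class `η := 0 ∈ P_U ⋂ H¹(G_k, M_X)` IS the Kummer class of the NF-constant `1`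
(trivial Kummer map), but the printed criterion asks for an NF-point, and there is none.
[cite: MochizukiAbsTopIII2015, Prop 1.8 (ii) p.36] -/
theorem forall_prop_1_8_ii_iff :
    (∀ M : IntrinsicKummerModel.{u}, M.Prop_1_8_ii) ↔
      ∀ (k : Type u) [Field k], ¬ IsKummerFaithful k := by
  constructor
  · intro hall k _ hk
    obtain ⟨M, U, h, hU, hsch, hg, hkf, _, hpt, hnf, hrat, hconst, hκ, f, hf⟩ := exists_junkModel_noPoints hk
    have hreg : f ∈ M.regularUnits U := fun x => isEmptyElim x
    have h1 : Units.map (algebraMap (M.base U) (M.FunctionField U) :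
        M.base U →* M.FunctionField U) 1 ∈ M.regularUnits U :=
      fun x => isEmptyElim x
    have hiff := hall M U U h hU hsch hsch hg hkf (fun c => isEmptyElim c) hnf
      ⟨⟨f, hreg⟩, hrat _, hf⟩ 0 (zero_mem _) (zero_mem _)
    obtain ⟨-, y, -⟩ := hiff.1 ⟨1, h1, hconst _, by rw [hκ]; rfl⟩
    exact isEmptyElim y
  · intro hno M U X h hX _ _ _ hk
    exact absurd hk (hno (M.base U))

/-- **F-0380: one Kummer-faithful field refutes the universal closure of `Prop_1_8_ii`.**
[cite: MochizukiAbsTopIII2015, Prop 1.8 (ii) p.36] -/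
theorem not_forall_prop_1_8_ii_of_isKummerFaithful {k : Type u} [Field k] (hk : IsKummerFaithful k) :
    ¬ ∀ M : IntrinsicKummerModel.{u}, M.Prop_1_8_ii :=
  fun h => forall_prop_1_8_ii_iff.1 h k hk

/-- **F-0380, universal closure REFUTED modulo F-0369** (`Rmk_1_5_4_i`), at `k := ℚ₂`, universe `0`.
The instance form `M.Prop_1_8_ii` at a coherent model is untouched.
[cite: MochizukiAbsTopIII2015, Prop 1.8 (ii) p.36] -/
theorem not_forall_prop_1_8_ii_of_rmk_1_5_4_i (h154 : Rmk_1_5_4_i.{0}) :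
    ¬ ∀ M : IntrinsicKummerModel.{0}, M.Prop_1_8_ii :=
  haveI : Fact (Nat.Prime 2) := ⟨Nat.prime_two⟩
  not_forall_prop_1_8_ii_of_isKummerFaithful (h154 ℚ_[2] (IsSubpadic.of_isMLF (isMLF_padic 2)))

end IntrinsicKummerModel

end Literature.AnabelianGeometry.AbsoluteAnabelian.AbsTopIII

end
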